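import Summits.BirchSwinnertonDyer.BirchSwinnertonDyer.Theorems.ThetaPartnerAtTwoSignedMainConjectureCMTwoRankZeroPTDeepCoindShapiro
import Literature.NumberTheory.EllipticCurves.WeilPairingProofs
import Literature.NumberTheory.GaloisRepresentations.ArchimedeanLocalDuality
import Literature.NumberTheory.GaloisRepresentations.BlochKatoSelmerGroup
import HarnessLib

/-!
# Route `ThetaPartnerAtTwo` (TP2), crux K2R0P♭ `SignedMainConjectureCMTwoRankZeroOfPubOfFlat` (item stmt-BirchSwinnertonDyer-26471),
# line `rankzero` v20, stub `stub_poitouTateDeepTwo`, hypothesis (E) `hE` of `…PTDeepClose.lean` — TRANSPORT LEMMAS for the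
# Poitou–Tate step on the Coind module: local classes of `Maps(Γ_ℚ ⧸ Γ_n, E[N])` versus their Weil-dual avatars

Width seat `bsd-wall-tp2-p2-w3` g3 (cell `bsd-wall`). THEOREMS ONLY (no definition, no named fact, no instance declaration, no `sorry`);
closes no item; BSD is NOT proved by any of this. Companion of `…PTDeepCoindShapiro.lean` (the local Shapiro dictionary); consumed by
`…PTDeepSelmerSocket.lean` (the levelwise Milne I 4.10 (b) step producing `hE`).

Notation (as in `…PTDeepCoindShapiro.lean`): `ρ = W.torsionGaloisModule N`, `ρc = ρ.coind Γ_n _ = Maps(Γ_ℚ ⧸ Γ_n, E[N])`,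
`Ψ = coindTateDualMor ρ ρ Γ_n (weilPairingHom …) : Maps ⟶ Maps^D` (the summed Weil duality, an ISOMORPHISM for `e` non-degenerate),
`Sh` the global Shapiro lift.

## What is proved
* `weilTowerPk_nondegenerate` — THE Weil pairings `CyclotomicLayer.weilTowerPk W k` of the tree are non-degenerate on the right
  (`eq_zero_of_weilPairingFun_eq_one`), the `hnondeg` input of the dictionary.
* `localization_eq_zero_of_localization_coindTateDual_eq_zero` — **`loc_w (H¹(Ψ) X) = 0 ⟹ loc_w X = 0`** at ANY place `w` (Ψ is an
  isomorphism; `localization_cohomologyMap_coindTateDualMor` + `bijective_cohomologyMap_of_bijective`).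
* `localization_mem_unramifiedSubgroup_of_coindTateDual` — **`loc_w (H¹(Ψ) X) ∈ H¹_ur(ℚ_w, ρc^D) ⟹ loc_w X ∈ H¹_ur(ℚ_w, ρc)`** at a finite
  place (restriction to `ℚ_w^{ur}` commutes with `H¹(Ψ)`, which is injective over `Γ_{ℚ_w^{ur}}` too).
* `eq_zero_of_forall_localTatePairingZMod_canonical_eq_zero` (finite `w`: `⊤^⊥ = 0` for THE canonical maps, `canonical_isPerfect`) and
  `eq_zero_of_forall_localTatePairingZMod_canonical_inl_eq_zero` (the infinite place: Milne I 2.13 (a), `localTatePairing_inl_eq_zero_of_forall_right`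
  with `canonical_injectiveAtRealPlaces`; every infinite place of `ℚ` is real) — the dual local condition of the RELAXED condition is ZERO.
* `toZModPow_mul_eq_zero_of_layerKummer_eq_zero` — a functional `z` on the local tower points, read mod `2^k` (times `2^{m₀}`), vanishes on
  `Q ∈ E(ℚ_{n,v})` with trivial layer Kummer class `κ_{U_n}(Q) = 0` (`Q ∈ N·E(ℚ_{n,v})` up to torsion, `subgroupKummerMap_eq_zero_iff`) — the
  well-definedness of the character `χ_z` on the Kummer image (design memo PT-DEEP-HALF-DESIGN-w2g4 §2 (a)).

References: [MilneADT2006] I Cor. 2.3, Thm. 2.6, Thm. 2.13 (a), Thm. 4.10 (b); [SilvermanAEC2009] III.8.1, VIII §2; [Kobayashi2003] (7.17)–(7.20).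
-/

set_option autoImplicit false
-- the Theorems namespace of this sub repeats the summit name by design (D-0017 nested layout)
set_option linter.dupNamespace false

noncomputable section

open scoped Classical

namespace Summit.BirchSwinnertonDyer.BirchSwinnertonDyer.Theorems

namespace SignedLowerOffTwo.PTDeep

open CategoryTheory Field NumberField IsDedekindDomain WeierstrassCurve
  Literature.NumberTheory.EllipticCurves Literature.NumberTheory.EllipticCurves.CyclotomicLayer
  Literature.NumberTheory.EllipticCurves.Kobayashi2003 Literature.NumberTheory.EllipticCurves.Sprung2012
  Literature.NumberTheory.GaloisRepresentations Literature.NumberTheory.GaloisRepresentations.DiscreteGaloisModule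
  Literature.NumberTheory.GaloisCohomology ZpExtension

-- Cup products need `LocallyCompactSpace Γ`; as in the K3 layer files the compactness of absolute Galois groups is a local instance only;
-- `E[N]` is finite (local instance, as in `CyclotomicLayerTatePairing.lean`).
attribute [local instance] absoluteGaloisGroup_compactSpace finite_geomTorsion_of_neZero

variable (W : WeierstrassCurve ℚ) [W.IsElliptic] (N : ℕ) [NeZero N]
  (e : geomTorsion W N → geomTorsion W N → AlgebraicClosure ℚ)
  (hμ : ∀ S T, e S T ^ N = 1)
  (hadd₁ : ∀ S₁ S₂ T, e (S₁ + S₂) T = e S₁ T * e S₂ T)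
  (hadd₂ : ∀ S T₁ T₂, e S (T₁ + T₂) = e S T₁ * e S T₂)
  (hgal : ∀ (σ : absoluteGaloisGroup ℚ) (S T : geomTorsion W N), σ • e S T = e (σ • S) (σ • T))
  {p : ℕ} [Fact p.Prime] (κ : ZpExtension ℚ p)

/-! ## §1 THE Weil pairings of the tree are non-degenerate -/

omit [NeZero N] in
/-- **`weilTowerPk W k` is non-degenerate on the right** (Silverman III.8.1 (c), the tree's `eq_zero_of_weilPairingFun_eq_one`).
[cite: SilvermanAEC2009, Prop. III.8.1 (c)] -/
theorem weilTowerPk_nondegenerate (k : ℕ) (T : geomTorsion W (p ^ k)) (hT : ∀ S, weilTowerPk (p := p) W k S T = 1) : T = 0 := by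
  have mem : ∀ S : geomTorsion W ((p ^ k : ℕ) : ℤ), ((p ^ k : ℕ) : ℤ) • (S : geomPoints W) = 0 := zsmul_coe_geomTorsion_pow W (p := p) k
  have h := eq_zero_of_weilPairingFun_eq_one (natCast_pow_prime_ne_zero (p := p) k) (mem T) fun S hS =>
    hT ⟨S, (mem_geomTorsion_iff W _ S).mpr hS⟩
  exact Subtype.ext h

/-! ## §2 `Ψ` is an isomorphism: transport of local vanishing and of the unramified condition -/

section Transport

variable (U : Subgroup (absoluteGaloisGroup ℚ)) (hU : IsOpen (U : Set (absoluteGaloisGroup ℚ))) [Fintype (absoluteGaloisGroup ℚ ⧸ U)]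
  (hnondeg : ∀ T, (∀ S, e S T = 1) → T = 0)

include hnondeg in
/-- **`loc_w (H¹(Ψ) X) = 0 ⟹ loc_w X = 0`** at every place `w` of `ℚ`, for `X ∈ H¹(ℚ, Maps(Γ_ℚ ⧸ U, E[N]))`: localisation intertwines
`H¹(Ψ)` with `H¹(Γ_{ℚ_w}, Ψ|)` (`localization_cohomologyMap_coindTateDualMor`), and the latter is injective because `Ψ` is bijective on the
(discrete) modules (`coindTateDualHom_bijective`, `bijective_weilPairingHom_flip`). [cite: MilneADT2006, Ch. I Cor. 2.3]
[cite: NeukirchSchmidtWingberg2008, I §5 (1.5.2)] -/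
theorem localization_eq_zero_of_localization_coindTateDual_eq_zero (w : Place ℚ)
    (X : galoisCohomology ((W.torsionGaloisModule (N : ℤ)).coind U hU) 1)
    (hX : galoisCohomology.localization (((W.torsionGaloisModule (N : ℤ)).coind U hU).tateDual N) w 1
      (cohomologyMap (coindTateDualMor (W.torsionGaloisModule (N : ℤ)) (W.torsionGaloisModule (N : ℤ)) U
          (weilPairingHom W N e hμ hadd₁ hadd₂) hU (fun σ S T => (weilContPairing W N e hμ hadd₁ hadd₂ hgal).toLin_smul σ S T)) 1 X) = 0) :
    galoisCohomology.localization ((W.torsionGaloisModule (N : ℤ)).coind U hU) w 1 X = 0 := by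
  rw [localization_cohomologyMap_coindTateDualMor] at hX
  haveI : DiscreteTopology (TopRep.res (absGaloisRestrict ℚ (Place.Completion w) :
      absoluteGaloisGroup (Place.Completion w) →* absoluteGaloisGroup ℚ)
        (coindFin.{0, 0} (W.torsionGaloisModule (N : ℤ)).toTopRep U)) :=
    inferInstanceAs (DiscreteTopology (absoluteGaloisGroup ℚ ⧸ U → geomTorsion W N))
  haveI : DiscreteTopology ((((W.torsionGaloisModule (N : ℤ)).coind U hU).tateDual N).toLocal w).toTopRep :=
    inferInstanceAs (DiscreteTopology (TateDual ℚ (absoluteGaloisGroup ℚ ⧸ U → geomTorsion W N) N))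
  have hinj := (bijective_cohomologyMap_of_bijective
    (TopRep.ofHom ⟨(coindTateDualMor (W.torsionGaloisModule (N : ℤ)) (W.torsionGaloisModule (N : ℤ)) U
        (weilPairingHom W N e hμ hadd₁ hadd₂) hU
        (fun σ S T => (weilContPairing W N e hμ hadd₁ hadd₂ hgal).toLin_smul σ S T)).hom.toContinuousLinearMap, fun d =>
      (coindTateDualMor (W.torsionGaloisModule (N : ℤ)) (W.torsionGaloisModule (N : ℤ)) U
        (weilPairingHom W N e hμ hadd₁ hadd₂) hU
        (fun σ S T => (weilContPairing W N e hμ hadd₁ hadd₂ hgal).toLin_smul σ S T)).hom.isIntertwining'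
          (absGaloisRestrict ℚ (Place.Completion w) d)⟩ :
      TopRep.res (absGaloisRestrict ℚ (Place.Completion w) : absoluteGaloisGroup (Place.Completion w) →* absoluteGaloisGroup ℚ)
        (coindFin.{0, 0} (W.torsionGaloisModule (N : ℤ)).toTopRep U) ⟶
          ((((W.torsionGaloisModule (N : ℤ)).coind U hU).tateDual N).toLocal w).toTopRep)
    (coindTateDualHom_bijective U (weilPairingHom W N e hμ hadd₁ hadd₂) (bijective_weilPairingHom_flip W N e hμ hadd₁ hadd₂ hnondeg)) 1).1
  exact hinj (hX.trans (map_zero _).symm)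

include hnondeg in
/-- **`loc_w (H¹(Ψ) X) ∈ H¹_ur(ℚ_w, Maps^D) ⟹ loc_w X ∈ H¹_ur(ℚ_w, Maps)`** at a finite place `w` (`unramifiedSubgroup` = kernel of the restriction to
`ℚ_w^{ur}`): restriction to `Γ_{ℚ_w^{ur}}` commutes with `H¹(Ψ|)` (on cocycles both are `d ↦ Ψ(X(θ d))`), and `H¹(Γ_{ℚ_w^{ur}}, Ψ)` is injective.
[cite: MilneADT2006, Ch. I Thm. 2.6] [cite: NeukirchSchmidtWingberg2008, I §5 (1.5.2)] -/
theorem localization_mem_unramifiedSubgroup_of_coindTateDual (w : HeightOneSpectrum (𝓞 ℚ))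
    (X : galoisCohomology ((W.torsionGaloisModule (N : ℤ)).coind U hU) 1)
    (hX : galoisCohomology.localization (((W.torsionGaloisModule (N : ℤ)).coind U hU).tateDual N) (Sum.inr w) 1
      (cohomologyMap (coindTateDualMor (W.torsionGaloisModule (N : ℤ)) (W.torsionGaloisModule (N : ℤ)) U
          (weilPairingHom W N e hμ hadd₁ hadd₂) hU (fun σ S T => (weilContPairing W N e hμ hadd₁ hadd₂ hgal).toLin_smul σ S T)) 1 X) ∈
        unramifiedSubgroup (GaloisRep.toLocal w (((W.torsionGaloisModule (N : ℤ)).coind U hU).tateDual N)) 1) :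
    galoisCohomology.localization ((W.torsionGaloisModule (N : ℤ)).coind U hU) (Sum.inr w) 1 X ∈
      unramifiedSubgroup (GaloisRep.toLocal w ((W.torsionGaloisModule (N : ℤ)).coind U hU)) 1 := by
  -- names
  let ρc := (W.torsionGaloisModule (N : ℤ)).coind U hU
  let Ψ := coindTateDualMor (W.torsionGaloisModule (N : ℤ)) (W.torsionGaloisModule (N : ℤ)) U
    (weilPairingHom W N e hμ hadd₁ hadd₂) hU (fun σ S T => (weilContPairing W N e hμ hadd₁ hadd₂ hgal).toLin_smul σ S T)
  let F := IsNonarchimedeanLocalField.maxUnramified (w.adicCompletion ℚ)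
  -- the composite restriction `Γ_{F} → Γ_{ℚ_w} → Γ_ℚ`
  let θ : absoluteGaloisGroup F →ₜ* absoluteGaloisGroup ℚ :=
    (absGaloisRestrict ℚ (w.adicCompletion ℚ)).comp (absGaloisRestrict (w.adicCompletion ℚ) F)
  -- `Ψ` restricted along `θ`
  let Ψθ : TopRep.res (θ : absoluteGaloisGroup F →* absoluteGaloisGroup ℚ) (coindFin.{0, 0} (W.torsionGaloisModule (N : ℤ)).toTopRep U) ⟶
      ((GaloisRep.toLocal w (ρc.tateDual N)).restrictField F).toTopRep :=
    TopRep.ofHom ⟨Ψ.hom.toContinuousLinearMap, fun d => Ψ.hom.isIntertwining' (θ d)⟩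
  replace hX := (mem_unramifiedSubgroup_iff _ _ _).mp hX
  refine (mem_unramifiedSubgroup_iff _ _ _).mpr ?_
  -- both restrictions read on cocycles
  obtain ⟨f, rfl⟩ := oneCocycleClass_surjective _ X
  have key : galoisCohomology.res (GaloisRep.toLocal w (ρc.tateDual N)) F 1
      (galoisCohomology.localization (ρc.tateDual N) (Sum.inr w) 1 (cohomologyMap Ψ 1 (oneCocycleClass ρc.toTopRep f))) =
      cohomologyMap Ψθ 1 (ContinuousCohomology.map θ
        (𝟙 (TopRep.res (θ : absoluteGaloisGroup F →* absoluteGaloisGroup ℚ) (coindFin.{0, 0} (W.torsionGaloisModule (N : ℤ)).toTopRep U)))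
        1 (oneCocycleClass ρc.toTopRep f)) := by
    change ContinuousCohomology.map _ _ 1 (ContinuousCohomology.map _ _ 1 (ContinuousCohomology.map _ _ 1 (oneCocycleClass _ f))) =
      ContinuousCohomology.map _ _ 1 (ContinuousCohomology.map _ _ 1 (oneCocycleClass _ f))
    erw [map_oneCocycleClass, map_oneCocycleClass, map_oneCocycleClass, map_oneCocycleClass, map_oneCocycleClass]
    rfl
  have hres0 : galoisCohomology.res (GaloisRep.toLocal w ρc) F 1
      (galoisCohomology.localization ρc (Sum.inr w) 1 (oneCocycleClass _ f)) =
      ContinuousCohomology.map θ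
        (𝟙 (TopRep.res (θ : absoluteGaloisGroup F →* absoluteGaloisGroup ℚ) (coindFin.{0, 0} (W.torsionGaloisModule (N : ℤ)).toTopRep U)))
        1 (oneCocycleClass ρc.toTopRep f) := by
    change ContinuousCohomology.map _ _ 1 (ContinuousCohomology.map _ _ 1 (oneCocycleClass _ f)) =
      ContinuousCohomology.map _ _ 1 (oneCocycleClass _ f)
    erw [map_oneCocycleClass, map_oneCocycleClass, map_oneCocycleClass]
    rfl
  haveI : DiscreteTopology (TopRep.res (θ : absoluteGaloisGroup F →* absoluteGaloisGroup ℚ)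
      (coindFin.{0, 0} (W.torsionGaloisModule (N : ℤ)).toTopRep U)) :=
    inferInstanceAs (DiscreteTopology (absoluteGaloisGroup ℚ ⧸ U → geomTorsion W N))
  haveI : DiscreteTopology ((GaloisRep.toLocal w (ρc.tateDual N)).restrictField F).toTopRep :=
    inferInstanceAs (DiscreteTopology (TateDual ℚ (absoluteGaloisGroup ℚ ⧸ U → geomTorsion W N) N))
  have hinj := (bijective_cohomologyMap_of_bijective Ψθ
    (coindTateDualHom_bijective U (weilPairingHom W N e hμ hadd₁ hadd₂) (bijective_weilPairingHom_flip W N e hμ hadd₁ hadd₂ hnondeg)) 1).1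
  have hX2 : cohomologyMap Ψθ 1 (ContinuousCohomology.map θ
      (𝟙 (TopRep.res (θ : absoluteGaloisGroup F →* absoluteGaloisGroup ℚ) (coindFin.{0, 0} (W.torsionGaloisModule (N : ℤ)).toTopRep U)))
      1 (oneCocycleClass ρc.toTopRep f)) = 0 := key ▸ hX
  change galoisCohomology.res (GaloisRep.toLocal w ρc) F 1 _ = 0
  rw [hres0]
  exact hinj (hX2.trans (map_zero _).symm)

end Transport

/-! ## §3 The dual of the RELAXED local condition is ZERO, for THE canonical maps (finite and infinite places) -/

/-- **`⊤^⊥ = 0` at a finite place** for THE canonical local invariant maps: a class `y ∈ H¹(ℚ_w, M^D)` annihilated by every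
`a ∈ H¹(ℚ_w, M)` vanishes (`LocalInvariants.canonical_isPerfect`: the flip adjoint is injective). [cite: MilneADT2006, Ch. I Cor. 2.3] -/
theorem eq_zero_of_forall_localTatePairingZMod_canonical_eq_zero {M : Type} [AddCommGroup M] [TopologicalSpace M] [DiscreteTopology M]
    [Finite M] (ρ : DiscreteGaloisModule ℚ M) (hM : ∀ m : M, N • m = 0) (w : HeightOneSpectrum (𝓞 ℚ))
    (y : galoisCohomology ((ρ.tateDual N).toLocal (Sum.inr w)) 1)
    (hy : ∀ a : galoisCohomology (ρ.toLocal (Sum.inr w)) 1,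
      localTatePairingZMod ρ N (Sum.inr w) (LocalInvariants.canonical ℚ N (Sum.inr w)) a y = 0) : y = 0 := by
  have h := ((LocalInvariants.canonical_isPerfect (K := ℚ) (n := N) w).2 ρ hM).2.1
  rw [← map_eq_zero_iff _ h]
  ext a
  rw [AddMonoidHom.flip_apply, hy, AddMonoidHom.zero_apply]

/-- **`⊤^⊥ = 0` at the infinite place** for THE canonical maps: a class `y ∈ H¹(ℚ_∞, M^D)` annihilated by every `a ∈ H¹(ℚ_∞, M)` vanishes —
archimedean local duality (Milne I 2.13 (a), the tree's `localTatePairing_inl_eq_zero_of_forall_right`), the canonical map at the (real)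
infinite place of `ℚ` being injective (`canonical_injectiveAtRealPlaces`). [cite: MilneADT2006, Ch. I Thm. 2.13] -/
theorem eq_zero_of_forall_localTatePairingZMod_canonical_inl_eq_zero {M : Type} [AddCommGroup M] [TopologicalSpace M]
    [DiscreteTopology M] [Finite M] (ρ : DiscreteGaloisModule ℚ M) (hM : ∀ m : M, N • m = 0) (w : InfinitePlace ℚ)
    (y : galoisCohomology ((ρ.tateDual N).toLocal (Sum.inl w)) 1)
    (hy : ∀ a : galoisCohomology (ρ.toLocal (Sum.inl w)) 1,
      localTatePairingZMod ρ N (Sum.inl w) (LocalInvariants.canonical ℚ N (Sum.inl w)) a y = 0) : y = 0 := by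
  have hinj : Function.Injective (LocalInvariants.canonical ℚ N (Sum.inl w)) :=
    LocalInvariants.canonical_injectiveAtRealPlaces.injective (IsTotallyReal.isReal w)
  refine localTatePairing_inl_eq_zero_of_forall_right ρ N hM w y fun a => hinj ?_
  rw [map_zero]
  exact hy a

/-! ## §4 The character `χ_z` is well defined on the layer Kummer image -/

/-- **A functional on the local tower points, read mod `p^k`, kills the kernel of the layer Kummer map**: if `κ_{U_n}(Q) = 0` for
`Q ∈ E(ℚ_{n,v})` and `N = p^k` then `Q = N·R + T` with `R ∈ E(ℚ_{n,v})`, `N·T = 0` (`subgroupKummerMap_eq_zero_iff`), so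
`z(Q) = N·z(R)` and `p^{m₀}·z(Q) ≡ 0 (mod p^k)`. [cite: SilvermanAEC2009, VIII §2 (pp. 190–191)] -/
theorem toZModPow_mul_eq_zero_of_layerKummer_eq_zero (v : HeightOneSpectrum (𝓞 ℚ)) (n k m₀ : ℕ) (hN : N = p ^ k)
    (z : localTowerPointsOfEmb κ (closureEmb (K := ℚ) (v.adicCompletion ℚ)) W →+ ℤ_[p])
    (Q : localPoints W (v.adicCompletion ℚ)) (hQ : Q ∈ localLayerPointsOfEmb κ (closureEmb (K := ℚ) (v.adicCompletion ℚ)) W n)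
    (hκQ : layerKummer W N κ v n ⟨Q, hQ⟩ = 0) :
    PadicInt.toZModPow k ((p : ℤ_[p]) ^ m₀ * z ⟨Q, localLayerPointsOfEmb_le_localTowerPointsOfEmb κ _ W n hQ⟩) = 0 := by
  have hNz : (N : ℤ) ≠ 0 := by exact_mod_cast NeZero.ne N
  have h0 : W.subgroupKummerMap (N : ℤ) (layerGroup κ v n) hNz
      (⟨Q, hQ⟩ : FixedPoints.addSubgroup (layerGroup κ v n) (localPoints W (v.adicCompletion ℚ))) = 0 := hκQ
  obtain ⟨R, hR, T, hT, hfix⟩ := (W.subgroupKummerMap_eq_zero_iff (N : ℤ) (layerGroup κ v n) hNz _).1 h0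
  -- `Q = N • (R - T)` with `R - T ∈ E(ℚ_{n,v})`
  have hT0 : (N : ℤ) • T = 0 := (Submodule.mem_torsionBy_iff (R := ℤ) _ _).mp hT
  have hQeq : Q = (N : ℤ) • (R - T) := by
    rw [smul_sub, hT0, sub_zero]
    exact hR.symm
  have hmem : R - T ∈ localTowerPointsOfEmb κ (closureEmb (K := ℚ) (v.adicCompletion ℚ)) W :=
    localLayerPointsOfEmb_le_localTowerPointsOfEmb κ _ W n hfix
  have hz : z ⟨Q, localLayerPointsOfEmb_le_localTowerPointsOfEmb κ _ W n hQ⟩ = (N : ℤ) • z ⟨R - T, hmem⟩ := by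
    rw [← map_zsmul]
    congr 1
    exact Subtype.ext hQeq
  have hpk : PadicInt.toZModPow k (((N : ℤ) : ℤ_[p])) = 0 := by
    rw [map_intCast, hN, Int.cast_natCast, ZMod.natCast_self]
  rw [hz, zsmul_eq_mul, map_mul, map_mul, hpk, zero_mul, mul_zero]

end SignedLowerOffTwo.PTDeep

end Summit.BirchSwinnertonDyer.BirchSwinnertonDyer.Theorems

end
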